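import Mathlib
import Summits.ValiantsHypothesis.ValiantsHypothesis.Theses.LiouvilleSarnak
import Summits.ValiantsHypothesis.ValiantsHypothesis.Theorems.LiouvilleSarnakAlignedCutRank
import Summits.ValiantsHypothesis.ValiantsHypothesis.Theorems.LiouvilleSarnakAlignedTypeIOfDigitalBilinear
import Summits.ValiantsHypothesis.ValiantsHypothesis.Theorems.LiouvilleSarnakLiouvilleCutRankOneBlock

/-!
# Route LiouvilleSarnak — crux `LiouvilleCutRank` (stmt-ValiantsHypothesis-14775):
# cuts aligned up to `k` stray row bits — the BOTTOM version

`Theorems/LiouvilleSarnakLiouvilleCutRankStrayRows.lean` (`le_rank_of_topRows`) proved the rank bound for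
cuts whose TOP `n₁ - k` positions are rows.  This file proves the mirror statement for cuts whose BOTTOM
`n₁ - k` positions are rows (the other `k` rows anywhere above, interleaved with the `n₁` columns):

* ★ `le_rank_of_bottomRows`: for all `W, k` there is `n₀` such that for every `n₁ ≥ n₀` and every
  balanced cut `π₁` of `2n₁` positions with `(π₁.symm j).isLeft` for all `j < n₁ - k`,
  `W ≤ rank M_{π₁}`.

Proof: freeze the `k` stray rows to a pattern `u`; with `T = n₁ - k` the column of the `u`-submatrix at
column digits `c` is `t ↦ λ(ofBits t + 2^T G(u, c) + 1)` — the `λ`-pattern of the aligned block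
`G(u, c) < 2^{n₁+k}`; every block index `y < 2^{n₁+k}` is some `G(u, c)`, in particular every
`y = b < 2^T`, whose column is COLUMN `b` of the aligned level-`T` matrix.  `AlignedCutRank` gives
`≥ 2^{k+W}` distinct aligned columns for `T` large; pigeonhole over the `2^k` patterns `u` gives one
pattern with `≥ 2^W` distinct columns, hence rank `≥ W`.  Together with the top version, every cut with
a PURE block of `n₁ - k` equal letters at the top OR at the bottom of a balanced window is covered
(`Theorems/LiouvilleSarnakLiouvilleCutRankStrayWindows.lean` transfers windows to all levels).

Honest framing: unconditional enlargement of the solved class of the OPEN crux `LiouvilleCutRank`;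
general cuts, `DigitalBilinearLiouville` and `AlgebraicSarnak` stay OPEN, and nothing here bears on VP
versus VNP.  No definitions. [cite: Coons2011, Theorem 1.5]
-/

-- the directory `ValiantsHypothesis/ValiantsHypothesis` repeats the summit name (tree layout)
set_option linter.dupNamespace false

namespace Summit.ValiantsHypothesis.ValiantsHypothesis.Theorems.LiouvilleSarnakLiouvilleCutRank.StrayRows

open Finset ArithmeticFunction

open Summit.ValiantsHypothesis.ValiantsHypothesis.Theses.LiouvilleSarnak (AlignedCutRank)
open Summit.ValiantsHypothesis.ValiantsHypothesis.Theorems.LiouvilleSarnakAligned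
  (alignedCutRank_proof card_image_row_le_two_pow_rank)
open Summit.ValiantsHypothesis.ValiantsHypothesis.Theorems.LiouvilleSarnak.AlignedTypeI.CharactersModTwoN
  (ofBits_injective_boolVec)
open Summit.ValiantsHypothesis.ValiantsHypothesis.Theorems.LiouvilleSarnakLiouvilleCutRank.OneBlock
  (rank_le_card_image_row)

/-- ★ **Cuts with a pure row block at the bottom have large rank.**  For all `W, k` there is `n₀` such
that for every `n₁ ≥ n₀` and every balanced cut `π₁` of the `2n₁` bit positions whose positions
`< n₁ - k` are all row bits, the Liouville cut matrix `M_{π₁}` has rank `≥ W`.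
[cite: Coons2011, Theorem 1.5] -/
theorem le_rank_of_bottomRows (W k : ℕ) : ∃ n₀ : ℕ, ∀ n₁ : ℕ, n₀ ≤ n₁ →
    ∀ π₁ : Fin n₁ ⊕ Fin n₁ ≃ Fin (2 * n₁),
      (∀ j : Fin (2 * n₁), (j : ℕ) < n₁ - k → (π₁.symm j).isLeft = true) →
      W ≤ (Matrix.of fun r c : Fin n₁ → Bool =>
        (((liouville (Nat.ofBits (fun j : Fin (2 * n₁) => Sum.elim r c (π₁.symm j)) + 1) : ℤ) :
          ℂ))).rank := by
  classical
  obtain ⟨T₀, hT₀⟩ := alignedCutRank_proof (2 ^ (k + W))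
  refine ⟨T₀ + k, fun n₁ hn₁ π₁ hbot => ?_⟩
  set T : ℕ := n₁ - k with hT
  set m : ℕ := n₁ + k with hm
  have hmT : T + m = 2 * n₁ := by omega
  have hTm : T ≤ m := by omega
  have hT₀T : T₀ ≤ T := by omega
  set M : Matrix (Fin n₁ → Bool) (Fin n₁ → Bool) ℂ := Matrix.of fun r c : Fin n₁ → Bool =>
      (((liouville (Nat.ofBits (fun j : Fin (2 * n₁) => Sum.elim r c (π₁.symm j)) + 1) : ℤ) : ℂ))
    with hM
  set N : (Fin n₁ → Bool) → (Fin n₁ → Bool) → ℕ := fun r c =>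
    Nat.ofBits (fun j : Fin (2 * n₁) => Sum.elim r c (π₁.symm j)) with hN
  -- the row index sitting at a bottom position
  have hbot' : ∀ j : Fin T, ∃ i : Fin n₁, π₁.symm ⟨j, by omega⟩ = Sum.inl i := fun j =>
    Sum.isLeft_iff.mp (hbot ⟨j, by omega⟩ (by have h := j.isLt; show (j : ℕ) < n₁ - k; omega))
  choose ρ hρ using hbot'
  have hπρ : ∀ j : Fin T, π₁ (Sum.inl (ρ j)) = ⟨j, by omega⟩ := fun j => by
    rw [← hρ j, Equiv.apply_symm_apply]
  have hρ_of_low : ∀ (i : Fin n₁) (h : (π₁ (Sum.inl i) : ℕ) < T), ρ ⟨π₁ (Sum.inl i), h⟩ = i := by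
    intro i h
    have h1 := hπρ ⟨π₁ (Sum.inl i), h⟩
    have h2 : (⟨(π₁ (Sum.inl i) : ℕ), by omega⟩ : Fin (2 * n₁)) = π₁ (Sum.inl i) := Fin.ext rfl
    rw [h2] at h1
    exact Sum.inl_injective (π₁.injective h1)
  -- rows ≃ stray part × bottom digits
  let U := {i : Fin n₁ // ¬ (π₁ (Sum.inl i) : ℕ) < T}
  let glue : (U → Bool) → (Fin T → Bool) → (Fin n₁ → Bool) := fun u t i =>
    if h : (π₁ (Sum.inl i) : ℕ) < T then t ⟨π₁ (Sum.inl i), h⟩ else u ⟨i, h⟩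
  have hbit_low : ∀ (u : U → Bool) (t : Fin T → Bool) (c : Fin n₁ → Bool) (j : ℕ) (hj : j < T),
      (N (glue u t) c).testBit j = t ⟨j, hj⟩ := by
    intro u t c j hj
    rw [hN]
    simp only
    rw [Nat.testBit_ofBits_lt _ _ (by omega), hρ ⟨j, hj⟩, Sum.elim_inl]
    simp only [glue]
    have h : (π₁ (Sum.inl (ρ ⟨j, hj⟩)) : ℕ) < T := by rw [hπρ]; exact hj
    rw [dif_pos h]
    congr 1
    exact Fin.ext (by simp [hπρ])
  have hbit_high : ∀ (u : U → Bool) (t t' : Fin T → Bool) (c : Fin n₁ → Bool) (j : ℕ), T ≤ j →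
      (N (glue u t) c).testBit j = (N (glue u t') c).testBit j := by
    intro u t t' c j hj
    by_cases hj2 : j < 2 * n₁
    · rw [hN]
      simp only
      rw [Nat.testBit_ofBits_lt _ _ hj2, Nat.testBit_ofBits_lt _ _ hj2]
      rcases hq : π₁.symm ⟨j, hj2⟩ with i | i
      · simp only [Sum.elim_inl, glue]
        have hi : ¬ (π₁ (Sum.inl i) : ℕ) < T := by
          have : π₁ (Sum.inl i) = ⟨j, hj2⟩ := by rw [← hq, Equiv.apply_symm_apply]
          rw [this]; exact not_lt.mpr hj
        rw [dif_neg hi, dif_neg hi]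
      · simp only [Sum.elim_inr]
    · rw [hN]
      simp only
      rw [Nat.testBit_ofBits_ge _ _ (not_lt.mp hj2), Nat.testBit_ofBits_ge _ _ (not_lt.mp hj2)]
  -- block index and decomposition `N = 2^T * G + ofBits t`
  set G : (U → Bool) → (Fin n₁ → Bool) → ℕ := fun u c => N (glue u (fun _ => false)) c / 2 ^ T
    with hG
  have hdecomp : ∀ (u : U → Bool) (t : Fin T → Bool) (c : Fin n₁ → Bool),
      N (glue u t) c = 2 ^ T * G u c + Nat.ofBits t := by
    intro u t c
    apply Nat.eq_of_testBit_eq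
    intro j
    rw [Nat.testBit_two_pow_mul_add _ (Nat.ofBits_lt_two_pow t)]
    by_cases hj : j < T
    · rw [if_pos hj, hbit_low u t c j hj, Nat.testBit_ofBits_lt _ _ hj]
    · rw [if_neg hj, hG]
      simp only
      rw [Nat.testBit_div_two_pow, show j - T + T = j by omega,
        hbit_high u t (fun _ => false) c j (not_lt.mp hj)]
  have hGlt : ∀ u c, G u c < 2 ^ m := by
    intro u c
    rw [hG]
    simp only
    rw [Nat.div_lt_iff_lt_mul (Nat.two_pow_pos T), ← pow_add, show m + T = 2 * n₁ by omega]
    exact Nat.ofBits_lt_two_pow _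
  -- every block index `y < 2^m` is some `G u c`
  have hGsurj : ∀ y : ℕ, y < 2 ^ m → ∃ u c, G u c = y := by
    intro y hy
    refine ⟨fun i => (2 ^ T * y).testBit (π₁ (Sum.inl i.1)),
      fun i => (2 ^ T * y).testBit (π₁ (Sum.inr i)), ?_⟩
    have hNy : N (glue (fun i => (2 ^ T * y).testBit (π₁ (Sum.inl i.1)))
        (fun _ => false)) (fun i => (2 ^ T * y).testBit (π₁ (Sum.inr i))) = 2 ^ T * y := by
      apply Nat.eq_of_testBit_eq
      intro j
      by_cases hj2 : j < 2 * n₁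
      · rw [hN]
        simp only
        rw [Nat.testBit_ofBits_lt _ _ hj2]
        rcases hq : π₁.symm ⟨j, hj2⟩ with i | i
        · have hi' : π₁ (Sum.inl i) = ⟨j, hj2⟩ := by rw [← hq, Equiv.apply_symm_apply]
          simp only [Sum.elim_inl, glue, hi']
          by_cases hjT : j < T
          · rw [dif_pos hjT, Nat.testBit_two_pow_mul]
            simp [not_le.mpr hjT]
          · rw [dif_neg hjT]
        · have hi' : π₁ (Sum.inr i) = ⟨j, hj2⟩ := by rw [← hq, Equiv.apply_symm_apply]
          simp only [Sum.elim_inr, hi']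
      · rw [hN]
        simp only
        rw [Nat.testBit_ofBits_ge _ _ (not_lt.mp hj2), Nat.testBit_two_pow_mul]
        have : y.testBit (j - T) = false :=
          Nat.testBit_lt_two_pow (lt_of_lt_of_le hy (Nat.pow_le_pow_right Nat.two_pos (by omega)))
        simp [this]
    rw [hG]
    simp only
    rw [hNy, Nat.mul_div_cancel_left _ (Nat.two_pow_pos T)]
  -- the column vectors of the stray-pattern submatrices
  set col : (U → Bool) → (Fin n₁ → Bool) → (Fin T → Bool) → ℂ := fun u c t => M (glue u t) c
    with hcol
  have hcol_eq : ∀ u c t, col u c t = (((liouville (2 ^ T * G u c + Nat.ofBits t + 1)) : ℤ) : ℂ) := by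
    intro u c t
    rw [hcol]
    simp only [hM, Matrix.of_apply]
    rw [show Nat.ofBits (fun j : Fin (2 * n₁) => Sum.elim (glue u t) c (π₁.symm j)) = N (glue u t) c
      from rfl, hdecomp]
  -- columns of the aligned level-`T` matrix appear among the columns
  set A : Matrix (Fin (2 ^ T)) (Fin (2 ^ T)) ℂ := Matrix.of fun a b : Fin (2 ^ T) =>
      (((liouville ((a : ℕ) + 2 ^ T * (b : ℕ) + 1) : ℤ) : ℂ)) with hA
  have hArank : 2 ^ (k + W) ≤ A.rank := hT₀ T hT₀T
  have hbm : ∀ b : Fin (2 ^ T), (b : ℕ) < 2 ^ m := fun b =>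
    lt_of_lt_of_le b.isLt (Nat.pow_le_pow_right Nat.two_pos hTm)
  choose ub cb hucb using fun b : Fin (2 ^ T) => hGsurj _ (hbm b)
  have hcol_col : ∀ (b : Fin (2 ^ T)) (t : Fin T → Bool),
      col (ub b) (cb b) t = A.transpose b ⟨Nat.ofBits t, Nat.ofBits_lt_two_pow t⟩ := by
    intro b t
    rw [hcol_eq, hucb b, Matrix.transpose_apply, hA, Matrix.of_apply]
    congr 3
    ring
  -- hence at least `2^(k+W)` distinct columns over all `(u, c)`
  set Cols : Finset ((Fin T → Bool) → ℂ) :=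
    (Finset.univ : Finset ((U → Bool) × (Fin n₁ → Bool))).image (fun p => col p.1 p.2) with hCols
  have hCols_card : 2 ^ (k + W) ≤ Cols.card := by
    let Ψ : (Fin (2 ^ T) → ℂ) → ((Fin T → Bool) → ℂ) :=
      fun f t => f ⟨Nat.ofBits t, Nat.ofBits_lt_two_pow t⟩
    have hΨ : Function.Injective Ψ := by
      intro f g hfg
      funext b
      obtain ⟨t, ht⟩ : ∃ t : Fin T → Bool, (⟨Nat.ofBits t, Nat.ofBits_lt_two_pow t⟩ : Fin (2 ^ T)) = b := by
        refine ⟨fun i => (b : ℕ).testBit i, Fin.ext ?_⟩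
        simp only
        rw [Nat.ofBits_testBit, Nat.mod_eq_of_lt b.isLt]
      have := congrFun hfg t
      simp only [Ψ, ht] at this
      exact this
    have hsub : (Finset.univ.image fun b : Fin (2 ^ T) => A.transpose b).image Ψ ⊆ Cols := by
      intro v hv
      obtain ⟨w, hw, rfl⟩ := Finset.mem_image.mp hv
      obtain ⟨b, -, rfl⟩ := Finset.mem_image.mp hw
      rw [hCols, Finset.mem_image]
      refine ⟨(ub b, cb b), Finset.mem_univ _, ?_⟩
      funext t
      exact hcol_col b t
    calc 2 ^ (k + W) ≤ A.rank := hArank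
      _ = A.transpose.rank := (Matrix.rank_transpose A).symm
      _ ≤ (Finset.univ.image fun b : Fin (2 ^ T) => A.transpose b).card :=
          rank_le_card_image_row A.transpose
      _ = ((Finset.univ.image fun b : Fin (2 ^ T) => A.transpose b).image Ψ).card :=
          (Finset.card_image_of_injective _ hΨ).symm
      _ ≤ Cols.card := Finset.card_le_card hsub
  -- pigeonhole over the `2^k` stray patterns
  have hk_card : Fintype.card (U → Bool) ≤ 2 ^ k := by
    rw [Fintype.card_fun, Fintype.card_bool]
    apply Nat.pow_le_pow_right Nat.two_pos
    have h1 : Fintype.card U =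
        Fintype.card (Fin n₁) - Fintype.card {i : Fin n₁ // (π₁ (Sum.inl i) : ℕ) < T} :=
      Fintype.card_subtype_compl _
    have h2 : Fintype.card {i : Fin n₁ // (π₁ (Sum.inl i) : ℕ) < T} ≤ Fintype.card (Fin n₁) :=
      Fintype.card_subtype_le _
    have hLow : T ≤ Fintype.card {i : Fin n₁ // (π₁ (Sum.inl i) : ℕ) < T} := by
      have hinj : Function.Injective (fun j : Fin T =>
          (⟨ρ j, by rw [hπρ]; exact j.isLt⟩ : {i : Fin n₁ // (π₁ (Sum.inl i) : ℕ) < T})) := by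
        intro j j' h
        have h1 : ρ j = ρ j' := congrArg Subtype.val h
        have h2 := hπρ j
        rw [h1, hπρ j'] at h2
        exact Fin.ext (by have := congrArg Fin.val h2; simpa using this.symm)
      have := Fintype.card_le_of_injective _ hinj
      simpa using this
    rw [Fintype.card_fin] at h1 h2
    omega
  have hexists : ∃ u : U → Bool, 2 ^ W ≤ (Finset.univ.image (col u)).card := by
    by_contra hno
    push Not at hno
    have hsub : Cols ⊆ Finset.univ.biUnion (fun u : U → Bool => Finset.univ.image (col u)) := by
      intro v hv
      rw [hCols, Finset.mem_image] at hv
      obtain ⟨p, -, rfl⟩ := hv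
      exact Finset.mem_biUnion.mpr ⟨p.1, Finset.mem_univ _, Finset.mem_image_of_mem _ (Finset.mem_univ _)⟩
    have h1 : Cols.card ≤ ∑ u : U → Bool, (Finset.univ.image (col u)).card :=
      (Finset.card_le_card hsub).trans Finset.card_biUnion_le
    have h2 : ∑ u : U → Bool, (Finset.univ.image (col u)).card ≤ ∑ _u : U → Bool, (2 ^ W - 1) :=
      Finset.sum_le_sum fun u _ => by have := hno u; omega
    rw [Finset.sum_const, Finset.card_univ, smul_eq_mul] at h2
    have h3 : Fintype.card (U → Bool) * (2 ^ W - 1) ≤ 2 ^ k * (2 ^ W - 1) :=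
      Nat.mul_le_mul_right _ hk_card
    have h4 : 2 ^ k * (2 ^ W - 1) < 2 ^ (k + W) := by
      rw [pow_add, Nat.mul_sub, mul_one]
      exact Nat.sub_lt (Nat.mul_pos (Nat.two_pow_pos k) (Nat.two_pow_pos W)) (Nat.two_pow_pos k)
    omega
  obtain ⟨u, hu⟩ := hexists
  -- the `u`-submatrix has `≥ 2^W` distinct columns, hence rank `≥ W`
  set S : Matrix (Fin T → Bool) (Fin n₁ → Bool) ℂ := M.submatrix (fun t => glue u t) id with hS
  have hST : ∀ i j, S.transpose i j = 1 ∨ S.transpose i j = -1 := by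
    intro c t
    simp only [Matrix.transpose_apply, hS, Matrix.submatrix_apply, id, hM, Matrix.of_apply]
    rw [liouville_apply (Nat.succ_ne_zero _)]
    rcases neg_one_pow_eq_or ℤ (cardFactors
      (Nat.ofBits (fun j : Fin (2 * n₁) => Sum.elim (glue u t) c (π₁.symm j)) + 1)) with h | h
    · left; rw [h]; norm_num
    · right; rw [h]; norm_num
  have hcols_S : (Finset.univ.image fun c : Fin n₁ → Bool => S.transpose c) =
      Finset.univ.image (col u) := by
    congr 1
  have h2W : 2 ^ W ≤ 2 ^ S.transpose.rank := by
    calc 2 ^ W ≤ (Finset.univ.image (col u)).card := hu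
      _ = (Finset.univ.image fun c : Fin n₁ → Bool => S.transpose c).card := by rw [hcols_S]
      _ ≤ 2 ^ S.transpose.rank := card_image_row_le_two_pow_rank _ hST
  calc W ≤ S.transpose.rank := (Nat.pow_le_pow_iff_right Nat.one_lt_two).mp h2W
    _ = S.rank := Matrix.rank_transpose S
    _ ≤ M.rank := Matrix.rank_submatrix_le M _ _

end Summit.ValiantsHypothesis.ValiantsHypothesis.Theorems.LiouvilleSarnakLiouvilleCutRank.StrayRows
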